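import Mathlib.Analysis.Complex.LocallyUniformLimit
import Mathlib.Analysis.SpecialFunctions.Pow.Deriv
import Mathlib.Analysis.Normed.Operator.Compact.Basic
import Mathlib.NumberTheory.LSeries.RiemannZeta
import Mathlib.Topology.ContinuousMap.Compact
import Mathlib.Topology.UniformSpace.CompactConvergence
import HarnessLib

/-!
# Mayer's transfer operator of the Gauss map

The transfer operator of the Gauss (continued fraction) map `T_G x = 1/x - ⌊1/x⌋`, introduced by
D. Mayer as an operator on the Banach space `B(D) = A_∞(D)` of functions holomorphic on the disc
`D = {z : |z - 1| < 3/2}` and continuous on its closure (sup norm):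

  `(L_s f)(z) = ∑_{n ≥ 1} (z + n)^{-2s} f(1/(z + n))`        (`Re s > 1/2`)

[Mayer1991, eq. (1) p. 57; Mayer1990, Prop. 1; ChangMayer2001, (2.6)–(2.7) and §2.4.6], together
with its analytic continuation to `Re s > 0`, `s ≠ 1/2` (the case `κ = 0`, `N = 0` of Mayer's
decomposition [Mayer1990, Thm. 5, eqs. (60)–(62); ChangMayer2001, (2.8)–(2.10)]):

  `(L_s f)(z) = f(0) ζ(2s, z + 1) + ∑_{n ≥ 1} (z + n)^{-2s} (f(1/(z + n)) - f(0))`,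

where `ζ(s, a)` is the Hurwitz zeta function with COMPLEX parameter `a`, `Re a > 0`.

## Contents

* `hurwitzZetaC s a` — the Hurwitz zeta function `ζ(s, a)` for complex `a` with `Re a > 0`, given
  for `Re s > 0`, `s ≠ 1` by the absolutely convergent series
  `ζ(s, a) = a^{1-s}/(s-1) + ∑_{n ≥ 0} [(n+a)^{-s} - ((n+a+1)^{1-s} - (n+a)^{1-s})/(1-s)]`
  (each bracket is `(n+a)^{-s} - ∫ₙ^{n+1} (x+a)^{-s} dx = O((n + Re a)^{-Re s - 1})`), and the
  difference equation `ζ(s, a) - ζ(s, a+1) = a^{-s}` (`hurwitzZetaC_sub_hurwitzZetaC_add_one`,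
  under summability, which holds in the stated range — the estimates are proved in a companion
  file). Mathlib's `HurwitzZeta.hurwitzZeta` takes `a : UnitAddCircle`
  only, which does not cover the parameter `a = z + 1`, `z ∈ D`, needed here.
* `mayerDisc`, `mayerClosedDisc` — Mayer's disc `D` and its closure; `one_div_add_mem_mayerDisc`:
  the inverse branches `z ↦ 1/(z+n)`, `n ≥ 1`, map the closed disc into `D`.
* `mayerSpace` / `MayerSpace` — the Banach space `B(D)`, realised as the (closed, hence complete:
  `isClosed_mayerSpace`, `instCompleteSpaceMayerSpace`) subspace of `C(D̄, ℂ)` (sup norm) of those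
  continuous functions on the closed disc that are holomorphic on the open disc.
* `mayerTerm`, `mayerSum`, `mayerSum₀` — the pointwise formulas: the `n`-th branch term, the raw sum
  (`Re s > 1/2`) and its `κ = 0` continuation (`Re s > 0`, `s ≠ 1/2`), on functions `ℂ → ℂ`.
* `IsMayerTransferAt s T` — the bounded operator `T` on `B(D)` acts by the continued formula;
  `IsMayerTransferAt.unique`. `mayerTransfer s : MayerSpace →L[ℂ] MayerSpace` — THE operator
  `L_s`: the unique such `T` when one exists (it does for `0 < Re s`, `s ≠ 1/2`, [Mayer1990, Thm. 5];
  the Lean proof of existence is the business of the companion files), and the junk value `0`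
  otherwise; `isMayerTransferAt_mayerTransfer`, `mayerTransfer_eq`.
* Named facts (cite-tagged `Prop`s, not proved here): `MayerTransferCompact` (compactness — the
  printed statement is nuclearity of order zero, [Mayer1990, Prop. 1 and Thm. 5]),
  `MayerTransferHolomorphic` (holomorphy of `s ↦ L_s` in operator norm off `s = 1/2`,
  [Mayer1990, Thm. 5]), `ChangMayerEigenvalueOne` (`ζ(2β) = 0`, `0 < Re β < 1/2` ⇒ `1` is an
  eigenvalue of `L_β`, [ChangMayer2001, Prop. 4.1(v)]).

## Design choices

* Branch: `(z + n) ^ (-(2 * s))` is Mathlib's principal-branch `cpow`; since `Re (z + n) > 0` on the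
  closed disc this agrees with Mayer's `(1/(z+n))^{2s}` and with the convention of the route file
  `Summits/RiemannHypothesis/RiemannHypothesis/Theses/MayerPairing.lean`.
* The defining formula of `IsMayerTransferAt` is the `κ = 0` continued one, valid on the larger
  region `Re s > 0`, `s ≠ 1/2`; for `Re s > 1/2` it agrees with the raw sum because
  `∑_{n ≥ 1} (z+n)^{-2s} = ζ(2s, z+1)` there [Mayer1990, (60)–(62)].
* Junk values (documented, never used by the named facts): `hurwitzZetaC 1 a` is junk (`s = 1` is
  the pole); consequently at `s = 1/2` the predicate `IsMayerTransferAt` describes the finite part of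
  `L_s` (residue term dropped), not Mayer's operator, which has a pole there; for `Re s ≤ 0` no
  claim is made. All named facts below restrict to `0 < Re s`, `s ≠ 1/2`.

## Not here (deliberately)

* Mayer's determinant formula `Z(s) = det(1 - L_s) det(1 + L_s)` [Mayer1991, Thm. 2]: neither
  Mathlib nor this tree has Fredholm determinants of nuclear/trace-class operators on a Banach or
  Hilbert space, nor the Selberg zeta function of `PSL₂(ℤ)`; vendoring it faithfully needs both.
* Nuclearity of order zero (Grothendieck) — only its consequence, compactness, is stated.
* The equivalence between eigenfunctions of `L_s` and solutions of the three-term (Lewis)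
  functional equation with the asymptotic criterion [ChangMayer2001, (2.46)–(2.49), (3.21)–(3.23),
  (4.15)] is to be PROVED from these definitions, not vendored.

## References

* [Mayer1990] D. Mayer, On the thermodynamic formalism for the Gauss map, CMP 130 (1990) 311–333,
  Prop. 1 (p. 314), Thm. 5 and eqs. (58)–(62) (pp. 325–327).
* [Mayer1991] D. Mayer, The thermodynamic formalism approach to Selberg's zeta function for
  PSL(2, ℤ), Bull. AMS 25 (1991) 55–60, eq. (1), Prop. 1, Thms. 1–2.
* [ChangMayer2001] C.-H. Chang, D. Mayer, Eigenfunctions of the transfer operators and the period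
  functions for modular groups, Contemp. Math. 290 (2001) 1–40, (2.6)–(2.12), §2.4.6, §3.2,
  Prop. 4.1 (held copy: PDF pp. 9–11, 18–19, 25, 29–30).
-/

noncomputable section

open Complex Metric Set Filter Topology

namespace Literature.Dynamics.TransferOperators

/-! ### The Hurwitz zeta function with complex parameter -/

/-- The `n`-th term `(n+a)^{-s} - ((n+a+1)^{1-s} - (n+a)^{1-s})/(1-s)` of the convergent series
for `ζ(s, a) - a^{1-s}/(s-1)`; it equals `(n+a)^{-s} - ∫ₙ^{n+1} (x+a)^{-s} dx` and is
`O((n + Re a)^{-Re s - 1})`. [folklore] -/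
def hurwitzZetaCTerm (s a : ℂ) (n : ℕ) : ℂ :=
  ((n : ℂ) + a) ^ (-s) - (((n : ℂ) + a + 1) ^ (1 - s) - ((n : ℂ) + a) ^ (1 - s)) / (1 - s)

/-- **Hurwitz zeta function with complex parameter.** For `Re a > 0`, `Re s > 0` and `s ≠ 1`,
`ζ(s, a) = a^{1-s}/(s-1) + ∑_{n ≥ 0} [(n+a)^{-s} - ((n+a+1)^{1-s} - (n+a)^{1-s})/(1-s)]`, the
analytic continuation in `s` of `∑_{n ≥ 0} (n+a)^{-s}` (`Re s > 1`) obtained by subtracting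
`∫₀^∞ (x+a)^{-s} dx = a^{1-s}/(s-1)` termwise (principal branches; `Re (n+a) > 0`). At `s = 1`
(the pole) the value is junk. [folklore] -/
def hurwitzZetaC (s a : ℂ) : ℂ :=
  ∑' n : ℕ, hurwitzZetaCTerm s a n + a ^ (1 - s) / (s - 1)

/-- Unfolding lemma for `hurwitzZetaC`. [folklore] -/
theorem hurwitzZetaC_def (s a : ℂ) :
    hurwitzZetaC s a = ∑' n : ℕ, hurwitzZetaCTerm s a n + a ^ (1 - s) / (s - 1) := rfl

/-- Shifting the parameter by one shifts the index: `term (n+1) a = term n (a+1)`. [folklore] -/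
theorem hurwitzZetaCTerm_succ (s a : ℂ) (n : ℕ) :
    hurwitzZetaCTerm s a (n + 1) = hurwitzZetaCTerm s (a + 1) n := by
  simp only [hurwitzZetaCTerm, Nat.cast_succ, add_assoc, add_comm (1 : ℂ) a]

/-- The zeroth term. [folklore] -/
theorem hurwitzZetaCTerm_zero (s a : ℂ) :
    hurwitzZetaCTerm s a 0 = a ^ (-s) - ((a + 1) ^ (1 - s) - a ^ (1 - s)) / (1 - s) := by
  simp [hurwitzZetaCTerm]

/-- **Difference equation** `ζ(s, a) - ζ(s, a+1) = a^{-s}` of the Hurwitz zeta function, for any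
`s ≠ 1` at which the defining series is summable (it is whenever `Re s > 0`, `Re a > 0`).
[folklore] -/
theorem hurwitzZetaC_sub_hurwitzZetaC_add_one {s a : ℂ} (hs : s ≠ 1)
    (h : Summable (hurwitzZetaCTerm s a)) :
    hurwitzZetaC s a - hurwitzZetaC s (a + 1) = a ^ (-s) := by
  have h1 : (1 - s) ≠ 0 := sub_ne_zero.mpr hs.symm
  have h2 : (s - 1) ≠ 0 := sub_ne_zero.mpr hs
  rw [hurwitzZetaC_def, hurwitzZetaC_def, h.tsum_eq_zero_add]
  simp only [hurwitzZetaCTerm_succ, hurwitzZetaCTerm_zero]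
  field_simp
  ring

/-! ### Mayer's disc `D = {z : |z - 1| < 3/2}` -/

/-- Mayer's disc `D = {z ∈ ℂ : |z - 1| < 3/2}`. [cite: Mayer1991, p. 57] -/
def mayerDisc : Set ℂ := ball (1 : ℂ) (3 / 2)

/-- The closed disc `D̄ = {z ∈ ℂ : |z - 1| ≤ 3/2}`. [cite: Mayer1991, p. 57] -/
def mayerClosedDisc : Set ℂ := closedBall (1 : ℂ) (3 / 2)

/-- Membership in Mayer's disc. [folklore] -/
@[simp] theorem mem_mayerDisc {z : ℂ} : z ∈ mayerDisc ↔ dist z 1 < 3 / 2 := Iff.rfl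

/-- Membership in the closed disc. [folklore] -/
@[simp] theorem mem_mayerClosedDisc {z : ℂ} : z ∈ mayerClosedDisc ↔ dist z 1 ≤ 3 / 2 := Iff.rfl

/-- Mayer's disc is open. [folklore] -/
theorem isOpen_mayerDisc : IsOpen mayerDisc := isOpen_ball

/-- The open disc lies in the closed disc. [folklore] -/
theorem mayerDisc_subset_mayerClosedDisc : mayerDisc ⊆ mayerClosedDisc := ball_subset_closedBall

/-- The closed disc is compact. [folklore] -/
theorem isCompact_mayerClosedDisc : IsCompact mayerClosedDisc := isCompact_closedBall _ _

/-- The closure of Mayer's disc is the closed disc. [folklore] -/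
theorem closure_mayerDisc : closure mayerDisc = mayerClosedDisc :=
  closure_ball (1 : ℂ) (by norm_num)

/-- `0 ∈ D` (so `f(0)` in the continued formula is an interior value). [folklore] -/
theorem zero_mem_mayerDisc : (0 : ℂ) ∈ mayerDisc := by
  simp [mayerDisc]; norm_num

/-- `0 ∈ D̄`. [folklore] -/
theorem zero_mem_mayerClosedDisc : (0 : ℂ) ∈ mayerClosedDisc :=
  mayerDisc_subset_mayerClosedDisc zero_mem_mayerDisc

/-- The closed disc is compact (needed for the sup norm on `C(D̄, ℂ)`). [folklore] -/
instance instCompactSpaceMayerClosedDisc : CompactSpace mayerClosedDisc :=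
  isCompact_iff_compactSpace.mp isCompact_mayerClosedDisc

/-- Points of the closed disc have real part at least `-1/2`. [folklore] -/
theorem re_ge_of_mem_mayerClosedDisc {z : ℂ} (hz : z ∈ mayerClosedDisc) : -(1 / 2 : ℝ) ≤ z.re := by
  rw [mem_mayerClosedDisc, dist_eq_norm] at hz
  have h := (abs_re_le_norm (z - 1)).trans hz
  rw [sub_re, one_re, abs_le] at h
  linarith [h.1]

/-- Inversion maps the half-plane `Re w ≥ 1/2` into the closed disc `|ζ - 1| ≤ 1`. [folklore] -/
theorem one_div_mem_closedBall_one_one {w : ℂ} (hw : (1 / 2 : ℝ) ≤ w.re) :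
    1 / w ∈ closedBall (1 : ℂ) 1 := by
  have hw0 : w ≠ 0 := fun h => by rw [h, zero_re] at hw; norm_num at hw
  have hn : 0 < ‖w‖ := norm_pos_iff.mpr hw0
  rw [mem_closedBall, dist_eq_norm, show 1 / w - 1 = (1 - w) / w by field_simp, norm_div,
    div_le_one hn, ← sq_le_sq₀ (norm_nonneg _) (norm_nonneg _), Complex.sq_norm, Complex.sq_norm,
    Complex.normSq_apply, Complex.normSq_apply]
  simp only [sub_re, one_re, sub_im, one_im, zero_sub, mul_neg, neg_mul, neg_neg]
  nlinarith

/-- The disc `|ζ - 1| ≤ 1` lies in Mayer's open disc. [folklore] -/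
theorem closedBall_one_one_subset_mayerDisc : closedBall (1 : ℂ) 1 ⊆ mayerDisc :=
  closedBall_subset_ball (by norm_num)

/-- The inverse branches of the Gauss map send the closed disc into the open disc:
`1/(z + n + 1) ∈ D` for `z ∈ D̄`, `n : ℕ`. [cite: Mayer1991, p. 57] -/
theorem one_div_add_mem_mayerDisc {z : ℂ} (hz : z ∈ mayerClosedDisc) (n : ℕ) :
    1 / (z + (n + 1)) ∈ mayerDisc := by
  refine closedBall_one_one_subset_mayerDisc (one_div_mem_closedBall_one_one ?_)
  have h := re_ge_of_mem_mayerClosedDisc hz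
  simp only [add_re, natCast_re, one_re]
  have hn : (0 : ℝ) ≤ n := n.cast_nonneg
  linarith

/-- The inverse branches send the closed disc into itself. [folklore] -/
theorem one_div_add_mem_mayerClosedDisc {z : ℂ} (hz : z ∈ mayerClosedDisc) (n : ℕ) :
    1 / (z + (n + 1)) ∈ mayerClosedDisc :=
  mayerDisc_subset_mayerClosedDisc (one_div_add_mem_mayerDisc hz n)

/-- On the closed disc, `Re (z + n + 1) ≥ 1/2 > 0`: the branch points of `(z+n+1)^{-2s}` are
avoided. [folklore] -/
theorem re_add_pos_of_mem_mayerClosedDisc {z : ℂ} (hz : z ∈ mayerClosedDisc) (n : ℕ) :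
    0 < (z + (n + 1)).re := by
  have h := re_ge_of_mem_mayerClosedDisc hz
  simp only [add_re, natCast_re, one_re]
  have hn : (0 : ℝ) ≤ n := n.cast_nonneg
  linarith

/-! ### The Banach space `B(D)` -/

open Classical in
/-- Extension by zero of a function on the closed disc to all of `ℂ` (the values off `D̄` are junk
and never used). [folklore] -/
def extDisc (g : mayerClosedDisc → ℂ) : ℂ → ℂ :=
  fun z => if h : z ∈ mayerClosedDisc then g ⟨z, h⟩ else 0

/-- `extDisc g` agrees with `g` on the closed disc. [folklore] -/
theorem extDisc_apply (g : mayerClosedDisc → ℂ) {z : ℂ} (hz : z ∈ mayerClosedDisc) :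
    extDisc g z = g ⟨z, hz⟩ := by
  simp only [extDisc, dif_pos hz]

/-- `extDisc g` vanishes off the closed disc (junk value). [folklore] -/
theorem extDisc_of_not_mem (g : mayerClosedDisc → ℂ) {z : ℂ} (hz : z ∉ mayerClosedDisc) :
    extDisc g z = 0 := by
  simp only [extDisc, dif_neg hz]

/-- `extDisc g` agrees with `g` on the closed disc (subtype form). [folklore] -/
@[simp] theorem extDisc_coe (g : mayerClosedDisc → ℂ) (z : mayerClosedDisc) :
    extDisc g z = g z := by
  rw [extDisc_apply g z.2]

/-- `extDisc` is additive. [folklore] -/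
theorem extDisc_add (g₁ g₂ : mayerClosedDisc → ℂ) :
    extDisc (g₁ + g₂) = extDisc g₁ + extDisc g₂ := by
  ext z
  by_cases hz : z ∈ mayerClosedDisc
  · simp only [Pi.add_apply, extDisc_apply _ hz]
  · simp only [Pi.add_apply, extDisc_of_not_mem _ hz, add_zero]

/-- `extDisc` commutes with scalars. [folklore] -/
theorem extDisc_smul (c : ℂ) (g : mayerClosedDisc → ℂ) : extDisc (c • g) = c • extDisc g := by
  ext z
  by_cases hz : z ∈ mayerClosedDisc
  · simp only [Pi.smul_apply, extDisc_apply _ hz]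
  · simp only [Pi.smul_apply, extDisc_of_not_mem _ hz, smul_zero]

/-- `extDisc 0 = 0`. [folklore] -/
@[simp] theorem extDisc_zero : extDisc (0 : mayerClosedDisc → ℂ) = 0 := by
  ext z
  by_cases hz : z ∈ mayerClosedDisc
  · simp only [Pi.zero_apply, extDisc_apply _ hz]
  · simp only [Pi.zero_apply, extDisc_of_not_mem _ hz]

/-- **Mayer's Banach space `B(D)`** (`A_∞(D)` in [Mayer1990, Mayer1991]): the space of functions
holomorphic on `D = {|z - 1| < 3/2}` and continuous on `D̄`, with the sup norm — realised as the
`ℂ`-subspace of `C(D̄, ℂ)` of those `g` that are complex-differentiable on the open disc.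
[cite: ChangMayer2001, (2.7) and the sentence after it] -/
def mayerSpace : Submodule ℂ C(mayerClosedDisc, ℂ) where
  carrier := {g | DifferentiableOn ℂ (extDisc g) mayerDisc}
  add_mem' {f g} hf hg := by
    simp only [mem_setOf_eq, ContinuousMap.coe_add, extDisc_add] at hf hg ⊢
    exact hf.add hg
  zero_mem' := by
    simp only [mem_setOf_eq, ContinuousMap.coe_zero, extDisc_zero]
    exact differentiableOn_const 0
  smul_mem' c f hf := by
    simp only [mem_setOf_eq, ContinuousMap.coe_smul, extDisc_smul] at hf ⊢
    exact hf.const_smul c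

/-- The Banach space `B(D)` as a type (normed `ℂ`-space structure inherited from `C(D̄, ℂ)`).
[cite: ChangMayer2001, (2.7)] -/
abbrev MayerSpace : Type := mayerSpace

/-- Membership in `B(D)`: holomorphy on the open disc. [folklore] -/
theorem mem_mayerSpace_iff {g : C(mayerClosedDisc, ℂ)} :
    g ∈ mayerSpace ↔ DifferentiableOn ℂ (extDisc g) mayerDisc := Iff.rfl

namespace MayerSpace

/-- The underlying function `ℂ → ℂ` of an element of `B(D)` (junk `0` off the closed disc). [folklore] -/
def toFun (f : MayerSpace) : ℂ → ℂ := extDisc (f : C(mayerClosedDisc, ℂ))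

/-- `f.toFun` agrees with `f` on the closed disc. [folklore] -/
theorem toFun_apply (f : MayerSpace) {z : ℂ} (hz : z ∈ mayerClosedDisc) :
    f.toFun z = (f : C(mayerClosedDisc, ℂ)) ⟨z, hz⟩ := extDisc_apply _ hz

/-- `f.toFun` agrees with `f` on the closed disc (subtype form). [folklore] -/
@[simp] theorem toFun_coe (f : MayerSpace) (z : mayerClosedDisc) :
    f.toFun z = (f : C(mayerClosedDisc, ℂ)) z := extDisc_coe _ z

/-- Elements of `B(D)` are holomorphic on the open disc. [folklore] -/
theorem differentiableOn_toFun (f : MayerSpace) : DifferentiableOn ℂ f.toFun mayerDisc := f.2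

/-- Elements of `B(D)` are continuous on the closed disc. [folklore] -/
theorem continuousOn_toFun (f : MayerSpace) : ContinuousOn f.toFun mayerClosedDisc := by
  rw [continuousOn_iff_continuous_restrict]
  convert (f : C(mayerClosedDisc, ℂ)).continuous using 1
  ext z
  simp [toFun]

/-- `toFun` is additive. [folklore] -/
theorem toFun_add (f g : MayerSpace) : (f + g).toFun = f.toFun + g.toFun := by
  simp [toFun, extDisc_add]

/-- `toFun` commutes with scalars. [folklore] -/
theorem toFun_smul (c : ℂ) (f : MayerSpace) : (c • f).toFun = c • f.toFun := by
  simp [toFun, extDisc_smul]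

/-- The sup norm controls point values. [folklore] -/
theorem norm_toFun_le (f : MayerSpace) {z : ℂ} (hz : z ∈ mayerClosedDisc) : ‖f.toFun z‖ ≤ ‖f‖ := by
  rw [toFun_apply f hz]
  exact ((f : C(mayerClosedDisc, ℂ)).norm_coe_le_norm ⟨z, hz⟩).trans_eq rfl

/-- The sup norm is the least bound on point values. [folklore] -/
theorem norm_le_of_forall_le (f : MayerSpace) {C : ℝ} (hC : 0 ≤ C)
    (h : ∀ z ∈ mayerClosedDisc, ‖f.toFun z‖ ≤ C) : ‖f‖ ≤ C := by
  change ‖(f : C(mayerClosedDisc, ℂ))‖ ≤ C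
  rw [ContinuousMap.norm_le _ hC]
  intro z
  simpa only [toFun_coe] using h z z.2

/-- Two elements of `B(D)` with the same point values on the closed disc are equal. [folklore] -/
theorem ext {f g : MayerSpace} (h : ∀ z ∈ mayerClosedDisc, f.toFun z = g.toFun z) : f = g :=
  Subtype.ext (ContinuousMap.ext fun z => by simpa only [toFun_coe] using h z z.2)

/-- **Constructor**: a function continuous on the closed disc and holomorphic on the open disc
defines an element of `B(D)`. [folklore] -/
def mk (F : ℂ → ℂ) (hc : ContinuousOn F mayerClosedDisc) (hd : DifferentiableOn ℂ F mayerDisc) :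
    MayerSpace :=
  ⟨⟨fun z => F z, continuousOn_iff_continuous_restrict.mp hc⟩,
    hd.congr fun _ hz => extDisc_apply _ (mayerDisc_subset_mayerClosedDisc hz)⟩

/-- Point values of `MayerSpace.mk F _ _` are those of `F`. [folklore] -/
@[simp] theorem mk_toFun_apply (F : ℂ → ℂ) (hc : ContinuousOn F mayerClosedDisc)
    (hd : DifferentiableOn ℂ F mayerDisc) {z : ℂ} (hz : z ∈ mayerClosedDisc) :
    (mk F hc hd).toFun z = F z := by
  rw [toFun_apply _ hz]; rfl

/-- Point evaluation at a point of the closed disc, as a continuous linear functional on `B(D)`. [folklore] -/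
def evalCLM (z : mayerClosedDisc) : MayerSpace →L[ℂ] ℂ :=
  (ContinuousMap.evalCLM ℂ z).comp mayerSpace.subtypeL

/-- `evalCLM z f = f z`. [folklore] -/
@[simp] theorem evalCLM_apply (z : mayerClosedDisc) (f : MayerSpace) :
    evalCLM z f = f.toFun z := by
  simp [evalCLM, toFun]

end MayerSpace

/-- `B(D)` is closed in `C(D̄, ℂ)`: a uniform limit on `D̄` of functions holomorphic on `D` is
holomorphic on `D` (Weierstrass). [folklore] -/
theorem isClosed_mayerSpace : IsClosed (mayerSpace : Set C(mayerClosedDisc, ℂ)) := by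
  refine IsSeqClosed.isClosed fun g G hg hG => ?_
  have hU : TendstoUniformly (fun n (x : mayerClosedDisc) => g n x) G atTop :=
    ContinuousMap.tendsto_iff_tendstoUniformly.mp hG
  have hL : TendstoLocallyUniformlyOn (fun n z => extDisc (g n) z) (extDisc G) atTop mayerDisc := by
    refine TendstoUniformlyOn.tendstoLocallyUniformlyOn ?_
    rw [Metric.tendstoUniformlyOn_iff]
    intro ε hε
    filter_upwards [(Metric.tendstoUniformly_iff.mp hU) ε hε] with n hn z hz
    rw [extDisc_apply _ (mayerDisc_subset_mayerClosedDisc hz),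
      extDisc_apply _ (mayerDisc_subset_mayerClosedDisc hz)]
    exact hn ⟨z, _⟩
  exact hL.differentiableOn (Eventually.of_forall fun n => hg n) isOpen_mayerDisc

/-- `B(D)` is a Banach space. [folklore] -/
instance instCompleteSpaceMayerSpace : CompleteSpace MayerSpace :=
  isClosed_mayerSpace.completeSpace_coe

/-! ### The pointwise formulas -/

/-- The `n`-th branch term of Mayer's operator, `(z + n + 1)^{-2s} F(1/(z + n + 1))` (`n : ℕ`, so
that the branches are indexed by `n + 1 ≥ 1`; principal branch of the power, `Re (z+n+1) > 0` on
the closed disc). [cite: Mayer1991, eq. (1)] -/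
def mayerTerm (s : ℂ) (F : ℂ → ℂ) (n : ℕ) (z : ℂ) : ℂ :=
  (z + (n + 1)) ^ (-(2 * s)) * F (1 / (z + (n + 1)))

/-- **Mayer's transfer operator, raw pointwise form**:
`(L_s F)(z) = ∑_{n ≥ 1} (z + n)^{-2s} F(1/(z+n))`, convergent for `Re s > 1/2` and `F` bounded on
the closed disc. [cite: Mayer1991, eq. (1)] -/
def mayerSum (s : ℂ) (F : ℂ → ℂ) (z : ℂ) : ℂ :=
  ∑' n : ℕ, mayerTerm s F n z

/-- **Mayer's transfer operator, `κ = 0` continued pointwise form**: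
`(L_s F)(z) = F(0) ζ(2s, z+1) + ∑_{n ≥ 1} (z + n)^{-2s} (F(1/(z+n)) - F(0))`, convergent for
`Re s > 0` (`s ≠ 1/2`) when `F` is bounded on the closed disc and Lipschitz at `0`; it agrees with
`mayerSum` for `Re s > 1/2`. [cite: Mayer1990, Thm. 5, eqs. (60)–(62) with N = 0] -/
def mayerSum₀ (s : ℂ) (F : ℂ → ℂ) (z : ℂ) : ℂ :=
  F 0 * hurwitzZetaC (2 * s) (z + 1) + ∑' n : ℕ, mayerTerm s (fun w => F w - F 0) n z

/-- Unfolding lemma for `mayerSum₀`. [folklore] -/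
theorem mayerSum₀_def (s : ℂ) (F : ℂ → ℂ) (z : ℂ) :
    mayerSum₀ s F z = F 0 * hurwitzZetaC (2 * s) (z + 1) +
      ∑' n : ℕ, (z + (n + 1)) ^ (-(2 * s)) * (F (1 / (z + (n + 1))) - F 0) := rfl

/-! ### The operator on `B(D)` -/

/-- `T : B(D) →L[ℂ] B(D)` **is Mayer's transfer operator at the parameter `s`**: it acts on every
`f ∈ B(D)` and at every point of the closed disc by the (`κ = 0` continued) formula `mayerSum₀`.
[cite: Mayer1990, Thm. 5, eqs. (60)–(62)] -/
def IsMayerTransferAt (s : ℂ) (T : MayerSpace →L[ℂ] MayerSpace) : Prop :=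
  ∀ f : MayerSpace, ∀ z : mayerClosedDisc, (T f).toFun z = mayerSum₀ s f.toFun z

/-- At most one bounded operator on `B(D)` acts by Mayer's formula. [folklore] -/
theorem IsMayerTransferAt.unique {s : ℂ} {T T' : MayerSpace →L[ℂ] MayerSpace}
    (hT : IsMayerTransferAt s T) (hT' : IsMayerTransferAt s T') : T = T' := by
  refine ContinuousLinearMap.ext fun f => Subtype.ext (ContinuousMap.ext fun z => ?_)
  have h := (hT f z).trans (hT' f z).symm
  simpa only [MayerSpace.toFun_coe] using h

open Classical in
/-- **Mayer's transfer operator `L_s : B(D) →L[ℂ] B(D)` of the Gauss map**, for every `s : ℂ`: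
the unique bounded operator acting by `(L_s f)(z) = f(0) ζ(2s, z+1) + ∑_{n≥1} (z+n)^{-2s}
(f(1/(z+n)) - f(0))` (`= ∑_{n≥1} (z+n)^{-2s} f(1/(z+n))` when `Re s > 1/2`) if such an operator
exists — it does for `0 < Re s`, `s ≠ 1/2` [Mayer1990, Thm. 5] — and the junk value `0` otherwise.
[cite: Mayer1991, eq. (1) and Thm. 1] -/
def mayerTransfer (s : ℂ) : MayerSpace →L[ℂ] MayerSpace :=
  if h : ∃ T, IsMayerTransferAt s T then h.choose else 0

/-- `mayerTransfer s` acts by Mayer's formula as soon as some bounded operator does. [folklore] -/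
theorem isMayerTransferAt_mayerTransfer {s : ℂ} (h : ∃ T, IsMayerTransferAt s T) :
    IsMayerTransferAt s (mayerTransfer s) := by
  rw [mayerTransfer, dif_pos h]
  exact h.choose_spec

/-- Any operator acting by Mayer's formula IS `mayerTransfer s`. [folklore] -/
theorem mayerTransfer_eq {s : ℂ} {T : MayerSpace →L[ℂ] MayerSpace} (hT : IsMayerTransferAt s T) :
    mayerTransfer s = T :=
  (isMayerTransferAt_mayerTransfer ⟨T, hT⟩).unique hT

/-- The junk case of `mayerTransfer`. [folklore] -/
theorem mayerTransfer_of_not_exists {s : ℂ} (h : ¬ ∃ T, IsMayerTransferAt s T) :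
    mayerTransfer s = 0 := by
  rw [mayerTransfer, dif_neg h]

/-- Pointwise action of `L_s`, given existence. [folklore] -/
theorem mayerTransfer_toFun_apply {s : ℂ} (h : ∃ T, IsMayerTransferAt s T) (f : MayerSpace)
    (z : mayerClosedDisc) : (mayerTransfer s f).toFun z = mayerSum₀ s f.toFun z :=
  isMayerTransferAt_mayerTransfer h f z

/-! ### Named facts (printed results, not proved here) -/

/-- **Compactness of Mayer's operator** (consequence of: `s ↦ L_s` is meromorphic in the whole
`s`-plane with values nuclear operators of order zero on `A_∞(D)`, poles only at `s = (1-k)/2`,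
`k = 0, 1, …`; nuclear ⇒ compact): for `0 < Re s`, `s ≠ 1/2`, `L_s` is a compact operator on
`B(D)`. [cite: Mayer1990, Prop. 1 and Thm. 5] -/
def MayerTransferCompact : Prop :=
  ∀ s : ℂ, 0 < s.re → s ≠ 1 / 2 → IsCompactOperator (mayerTransfer s)

/-- **Holomorphy of the family `s ↦ L_s`** in operator norm on `{0 < Re s} \ {1/2}` (printed: the
family is meromorphic in the `s`-plane with simple poles at `s = (1-k)/2`, `k = 0, 1, …`).
[cite: Mayer1990, Thm. 5] -/
def MayerTransferHolomorphic : Prop :=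
  DifferentiableOn ℂ (fun s : ℂ => mayerTransfer s) {s : ℂ | 0 < s.re ∧ s ≠ 1 / 2}

/-- **Zeros of `ζ(2β)` give the eigenvalue `1` of `L_β`** (Chang–Mayer / Efrat): for `β` with
`0 < Re β < 1/2` and `ζ(2β) = 0`, the function `f_β(z) = ψ_β(z+1)` (`ψ_β` the continuation of
Zagier's `∑_{m,n≥1} (mz+n)^{-2β} + ½ ζ(2β)(1 + z^{-2β})`) is an eigenfunction of `L_β` with
eigenvalue `+1`; recorded here in the weaker form "1 is an eigenvalue of `L_β` on `B(D)`" (the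
nontrivial zeros only, where `L_β` has no pole). [cite: ChangMayer2001, Prop. 4.1(v)] -/
def ChangMayerEigenvalueOne : Prop :=
  ∀ β : ℂ, 0 < β.re → β.re < 1 / 2 → riemannZeta (2 * β) = 0 →
    ∃ f : MayerSpace, f ≠ 0 ∧ mayerTransfer β f = f

end Literature.Dynamics.TransferOperators
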